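import Summits.CriticalPhenomena.CardyFormulaZ2.Theorems.CardyIKTransportIKLinearTransportThetaEnclosure

/-!
# `CardyIKTransport.IKLinearTransport` (stmt-CriticalPhenomena-5076, line `pinned-diagram-exchange`, lead c8 wave 1) —
# theta-enclosure, part 4: the CHAIN form `thetaEnclosureChain` (registered stub)

Support file (`--supports stmt-CriticalPhenomena-5076`), on top of the three theta-enclosure files (`…ThetaEnclosureWinding`,
`…ThetaEnclosureRefine`, `…ThetaEnclosure`).  THE STATEMENT (`thetaEnclosureChain`) is the shape the line's two-profile
event certifies: in the cell triangulation `cellGraph A`, a LINK `RelR y y'` (resp. `RelL y y'`) is a black (`⊆ K`) cell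
path in the closed right (resp. left) half-plane of the wall column `a`, inside the sup-box of radius `M` around the wall
cell `p = (a, r)`, from `(a, y)` to `(a, y')`.  Given a right CROSSING link `u → v` and a left crossing link `u' → v'`
(`u, u'` in a set `U` of rows above `r`, `v, v'` in a set `D` of rows below `r`), an UPPER CHAIN of links (either side)
from `u'` to `u` with all endpoints in `U`, a LOWER CHAIN from `v'` to `v` with all endpoints in `D`, and `p ∉ K`, every
cell path off `K` from `p` stays within sup-distance `M` of `p`.  (`thetaEnclosure` is the case of two vertical wall runs.)

THE PROOF is that of part 3 with the wall runs replaced by refined chains.  Each link is refined in mode V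
(`refineV_chain`) to a `ℤ²`-walk between the doubled wall cells, V-owned by `K` and inside the doubled box
(`link_walk`); around `2p` a LEFT link winds `0` (`Z2HalfPlane.walkWinding_eq_zero_of_right`) and a RIGHT link from row
`y` to row `y'` winds `[2r + 1 ≤ 2y'] - [2r + 1 ≤ 2y]` (`walkWinding_telescope`: at abscissa `2a` the critical rows
`2r, 2r + 1` hold `2p` and the midpoint above it, owned by the white cell `p`), which is `0` when `y, y'` lie on the same
side of `r`.  A chain is refined by induction on `Relation.ReflTransGen` (`chain_walk`), with total winding `0`.  The closed
walk `C = (u → v) + (lower chain)⁻¹ + (u' → v')⁻¹ + (upper chain)` therefore winds `-1` around `2p`; the refined white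
path avoids `C` (`own_disjoint`), the winding number of `C` is constant along it (`walkWinding_closed_const`) and vanishes
off the doubled box (`walkWinding_closed_box`).
-/

noncomputable section

namespace Summit.CriticalPhenomena.CardyFormulaZ2.Theorems.IKLinearTransport.PinnedDiagramExchange

open Literature.Probability.Percolation Literature.Probability.LatticeModels
open SimpleGraph

namespace ThetaEnclosureStub

/-- Ownership of a doubled vertex by the colour class `S` along refinements in mode V (local notation, as in part 2). -/
local notation3 "OwnV[" S ", " A "] " z:max =>
  ((∀ i j : ℤ, (z : Site 2) 0 = 2 * i → (z : Site 2) 1 = 2 * j → (![i, j] : Site 2) ∈ S) ∧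
    (∀ i j : ℤ, (z : Site 2) 0 = 2 * i + 1 → (z : Site 2) 1 = 2 * j → (![i, j] : Site 2) ∈ S ∨ (![i + 1, j] : Site 2) ∈ S) ∧
    (∀ i j : ℤ, (z : Site 2) 0 = 2 * i → (z : Site 2) 1 = 2 * j + 1 → (![i, j] : Site 2) ∈ S ∧ (![i, j + 1] : Site 2) ∈ S) ∧
    (∀ i j : ℤ, (z : Site 2) 0 = 2 * i + 1 → (z : Site 2) 1 = 2 * j + 1 →
      ((![i, j] : Site 2) ∉ A → (![i, j] : Site 2) ∈ S ∧ (![i + 1, j + 1] : Site 2) ∈ S) ∧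
      ((![i, j] : Site 2) ∈ A → (![i, j + 1] : Site 2) ∈ S ∧ (![i + 1, j] : Site 2) ∈ S)))

/-! ### Refined links and chains -/

/-- **Refinement of a link.**  A black cell path inside the sup-box of radius `M` around the white wall cell `(a, r)`,
from the wall cell `(a, y)` to `(a, y')`, refines (mode V) to a `ℤ²`-walk between the doubled wall cells, V-owned by `K`
and inside the doubled box; around `2 (a, r)` it winds `0` if the path lies in the left half-plane `{x ≤ a}`, and
`[2r + 1 ≤ 2y'] - [2r + 1 ≤ 2y]` if it lies in the right half-plane `{x ≥ a}`. [folklore] -/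
theorem link_walk {A K : Set (Site 2)} {a r : ℤ} {M : ℕ} (hp : (![a, r] : Site 2) ∉ K) {y y' : ℤ}
    {γ : List (Site 2)} (hc : List.IsChain (cellGraph A).Adj γ) (hh : γ.head? = some ![a, y])
    (ht : γ.getLast? = some ![a, y']) (hγ : ∀ v ∈ γ, v ∈ K ∧ |v 0 - a| ≤ M ∧ |v 1 - r| ≤ M) :
    ∃ W : (zdGraph 2).Walk (triDouble ![a, y]) (triDouble ![a, y']),
      (∀ z ∈ W.support, OwnV[K, A] z ∧
        2 * a - 2 * M ≤ z 0 ∧ z 0 ≤ 2 * a + 2 * M ∧ 2 * r - 2 * M ≤ z 1 ∧ z 1 ≤ 2 * r + 2 * M) ∧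
      ((∀ v ∈ γ, v 0 ≤ a) → walkWinding W (triDouble ![a, r]) = 0) ∧
      ((∀ v ∈ γ, a ≤ v 0) → walkWinding W (triDouble ![a, r]) =
        (if 2 * r + 1 ≤ 2 * y' then 1 else 0) - (if 2 * r + 1 ≤ 2 * y then 1 else 0)) := by
  obtain ⟨W, -, hW⟩ := refineV_chain (S := K) (A := A) γ _ _ hc hh ht fun w hw => (hγ w hw).1
  have habs : ∀ {x c : ℤ}, |x - c| ≤ (M : ℤ) → c - M ≤ x ∧ x ≤ c + M := fun h => by
    have := abs_le.1 h; omega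
  refine ⟨W, fun z hz => ?_, fun hleft => ?_, fun hright => ?_⟩
  · obtain ⟨hown, u, hu, w, hw, hbox⟩ := hW z hz
    have h1 := habs (hγ u hu).2.1; have h2 := habs (hγ u hu).2.2
    have h3 := habs (hγ w hw).2.1; have h4 := habs (hγ w hw).2.2
    exact ⟨hown, by omega, by omega, by omega, by omega⟩
  · exact Z2HalfPlane.walkWinding_eq_zero_of_right fun z hz => by
      obtain ⟨-, u, hu, w, hw, hbox⟩ := hW z hz
      have hu0 := hleft u hu; have hw0 := hleft w hw
      simp only [triDouble_apply_zero, Matrix.cons_val_zero]; omega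
  · rw [walkWinding_telescope W _ ?_]
    · simp only [triDouble_apply_one, Matrix.cons_val_one, Matrix.cons_val_fin_one]
    · intro z hz hz1
      obtain ⟨hown, u, hu, w, hw, hbox⟩ := hW z hz
      have hu0 := hright u hu; have hw0 := hright w hw
      simp only [triDouble_apply_zero, triDouble_apply_one, Matrix.cons_val_zero, Matrix.cons_val_one,
        Matrix.cons_val_fin_one] at hz1 ⊢
      by_contra hlt
      have hz0 : z 0 = 2 * a := by omega
      rcases hz1 with hz1 | hz1
      · exact hp (hown.1 a r hz0 hz1)
      · exact hp (hown.2.2.1 a r hz0 hz1).1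

/-- **Refinement of a chain of links** (induction on `Relation.ReflTransGen`).  A chain of left/right links whose
endpoints all lie on ONE side of the row `r` (all in `E`, `E` above or below `r`), starting at a black wall cell
`(a, y₀)` of the box, refines to a `ℤ²`-walk V-owned by `K`, inside the doubled box, winding `0` around `2 (a, r)`
(left links wind `0`, right links `[2r + 1 ≤ 2y'] - [2r + 1 ≤ 2y] = 0` for `y, y'` on the same side). [folklore] -/
theorem chain_walk {A K : Set (Site 2)} {a r : ℤ} {M : ℕ} (hp : (![a, r] : Site 2) ∉ K) {RL RR : ℤ → ℤ → Prop}
    (hRL : ∀ y y', RL y y' → ∃ γ : List (Site 2), List.IsChain (cellGraph A).Adj γ ∧ γ.head? = some ![a, y] ∧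
      γ.getLast? = some ![a, y'] ∧ ∀ v ∈ γ, v ∈ K ∧ v 0 ≤ a ∧ |v 0 - a| ≤ M ∧ |v 1 - r| ≤ M)
    (hRR : ∀ y y', RR y y' → ∃ γ : List (Site 2), List.IsChain (cellGraph A).Adj γ ∧ γ.head? = some ![a, y] ∧
      γ.getLast? = some ![a, y'] ∧ ∀ v ∈ γ, v ∈ K ∧ a ≤ v 0 ∧ |v 0 - a| ≤ M ∧ |v 1 - r| ≤ M)
    {E : Set ℤ} (hE : (∀ y ∈ E, r < y) ∨ (∀ y ∈ E, y < r)) {y₀ : ℤ} (hK₀ : (![a, y₀] : Site 2) ∈ K)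
    (hM₀ : |y₀ - r| ≤ M) {y : ℤ} (h : Relation.ReflTransGen (fun y y' => y ∈ E ∧ y' ∈ E ∧ (RL y y' ∨ RR y y')) y₀ y) :
    ∃ W : (zdGraph 2).Walk (triDouble ![a, y₀]) (triDouble ![a, y]), walkWinding W (triDouble ![a, r]) = 0 ∧
      ∀ z ∈ W.support, OwnV[K, A] z ∧
        2 * a - 2 * M ≤ z 0 ∧ z 0 ≤ 2 * a + 2 * M ∧ 2 * r - 2 * M ≤ z 1 ∧ z 1 ≤ 2 * r + 2 * M := by
  induction h with
  | refl =>
    refine ⟨Walk.nil, walkWinding_nil _ _, fun z hz => ?_⟩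
    rw [Walk.support_nil, List.mem_singleton] at hz
    subst hz
    have := abs_le.1 hM₀
    refine ⟨ownV_double hK₀, ?_⟩
    simp only [triDouble_apply_zero, triDouble_apply_one, Matrix.cons_val_zero, Matrix.cons_val_one,
      Matrix.cons_val_fin_one]
    omega
  | @tail b c _ hbc ih =>
    obtain ⟨W, hW0, hW⟩ := ih
    obtain ⟨hbE, hcE, hl | hr⟩ := hbc
    · obtain ⟨γ, hc, hh, ht, hγ⟩ := hRL b c hl
      obtain ⟨W', hW', hleft, -⟩ := link_walk hp hc hh ht fun v hv => ⟨(hγ v hv).1, (hγ v hv).2.2⟩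
      refine ⟨W.append W', ?_, fun z hz => ?_⟩
      · rw [walkWinding_append, hW0, hleft fun v hv => (hγ v hv).2.1, add_zero]
      · rw [Walk.mem_support_append_iff] at hz
        exact hz.elim (hW z) (hW' z)
    · obtain ⟨γ, hc, hh, ht, hγ⟩ := hRR b c hr
      obtain ⟨W', hW', -, hright⟩ := link_walk hp hc hh ht fun v hv => ⟨(hγ v hv).1, (hγ v hv).2.2⟩
      refine ⟨W.append W', ?_, fun z hz => ?_⟩
      · rw [walkWinding_append, hW0, hright fun v hv => (hγ v hv).2.1, zero_add]
        rcases hE with hE | hE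
        · have hb := hE b hbE
          have hc' := hE c hcE
          rw [if_pos (by omega), if_pos (by omega), sub_self]
        · have hb := hE b hbE
          have hc' := hE c hcE
          rw [if_neg (by omega), if_neg (by omega), sub_self]
      · rw [Walk.mem_support_append_iff] at hz
        exact hz.elim (hW z) (hW' z)

end ThetaEnclosureStub

open ThetaEnclosureStub in
/-- **Theta-enclosure, chain form (registered stub `thetaEnclosureChain` of the line `pinned-diagram-exchange`).**
In the cell triangulation `cellGraph A`, let `RelR y y'` (resp. `RelL y y'`) mean: a cell path in `K`, in the closed
right (resp. left) half-plane of the column `a` and inside the sup-box of radius `M` around `(a, r)`, from `(a, y)` to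
`(a, y')`.  Given rows `U` above `r` and `D` below `r`, a right link `u → v` and a left link `u' → v'` with `u, u' ∈ U`,
`v, v' ∈ D`, a chain of links with all endpoints in `U` from `u'` to `u`, a chain with all endpoints in `D` from `v'` to
`v`, and `(a, r) ∉ K`, every cell path off `K` starting at `(a, r)` stays within sup-distance `M` of `(a, r)`: the closed
black curve (right link, lower chain reversed, left link reversed, upper chain) winds `-1` around the doubled white cell
and cannot be crossed by a white path (Kesten 1982, §2.3; parts 1–3 of the theta-enclosure). [folklore] -/
theorem thetaEnclosureChain : ∀ (A K : Set (Site 2)) (a r : ℤ) (M : ℕ) (U D : Set ℤ), (∀ y ∈ U, r < y) → (∀ y ∈ D, y < r) → let RelR : ℤ → ℤ → Prop := fun y y' => ∃ γ : List (Site 2), List.IsChain (cellGraph A).Adj γ ∧ γ.head? = some ![a, y] ∧ γ.getLast? = some ![a, y'] ∧ ∀ v ∈ γ, v ∈ K ∧ a ≤ v 0 ∧ |v 0 - a| ≤ M ∧ |v 1 - r| ≤ M; let RelL : ℤ → ℤ → Prop := fun y y' => ∃ γ : List (Site 2), List.IsChain (cellGraph A).Adj γ ∧ γ.head? = some ![a,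 y] ∧ γ.getLast? = some ![a, y'] ∧ ∀ v ∈ γ, v ∈ K ∧ v 0 ≤ a ∧ |v 0 - a| ≤ M ∧ |v 1 - r| ≤ M; ∀ (u u' v v' : ℤ), u ∈ U → u' ∈ U → v ∈ D → v' ∈ D → RelR u v → RelL u' v' → Relation.ReflTransGen (fun y y' => y ∈ U ∧ y' ∈ U ∧ (RelL y y' ∨ RelR y y')) u' u → Relation.ReflTransGen (fun y y' => y ∈ D ∧ y' ∈ D ∧ (RelL y y' ∨ RelR y y')) v' v → ![a, r] ∉ K → ∀ π : List (Site 2), List.IsChain (cellGraph A).Adj π → (∀ w ∈ π, w ∉ K) → π.head? = some ![a, r] → ∀ w ∈ π, |w 0 - a| ≤ M ∧ |w 1 - r| ≤ M := by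
  intro A K a r M U D hU hD RelR RelL u u' v v' hu hu' hv hv' hR hL hUp hDn hp π hcπ hKπ hhπ w hw
  -- the two crossing links
  obtain ⟨γR, hcR, hhR, htR, hγR⟩ := hR
  obtain ⟨γL, hcL, hhL, htL, hγL⟩ := hL
  have hKu' : (![a, u'] : Site 2) ∈ K ∧ |u' - r| ≤ M :=
    ⟨(hγL _ (List.mem_of_mem_head? hhL)).1, by simpa using (hγL _ (List.mem_of_mem_head? hhL)).2.2.2⟩
  have hKv' : (![a, v'] : Site 2) ∈ K ∧ |v' - r| ≤ M :=
    ⟨(hγL _ (List.mem_of_getLast? htL)).1, by simpa using (hγL _ (List.mem_of_getLast? htL)).2.2.2⟩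
  obtain ⟨WR, hWR, -, hWRw⟩ := link_walk hp hcR hhR htR fun x hx => ⟨(hγR x hx).1, (hγR x hx).2.2⟩
  obtain ⟨WL, hWL, hWLw, -⟩ := link_walk hp hcL hhL htL fun x hx => ⟨(hγL x hx).1, (hγL x hx).2.2⟩
  -- the two chains
  obtain ⟨WU, hWU0, hWU⟩ := chain_walk (RL := RelL) (RR := RelR) hp (fun _ _ h => h) (fun _ _ h => h)
    (E := U) (Or.inl hU) hKu'.1 hKu'.2 hUp
  obtain ⟨WD, hWD0, hWD⟩ := chain_walk (RL := RelL) (RR := RelR) hp (fun _ _ h => h) (fun _ _ h => h)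
    (E := D) (Or.inr hD) hKv'.1 hKv'.2 hDn
  -- the closed black curve
  set C := WR.append (WD.reverse.append (WL.reverse.append WU)) with hC
  have hCmem : ∀ z ∈ C.support, z ∈ WR.support ∨ z ∈ WD.support ∨ z ∈ WL.support ∨ z ∈ WU.support := by
    intro z hz
    simp only [hC, Walk.mem_support_append_iff, Walk.support_reverse, List.mem_reverse] at hz
    tauto
  have hCbox : ∀ z ∈ C.support,
      2 * a - 2 * M ≤ z 0 ∧ z 0 ≤ 2 * a + 2 * M ∧ 2 * r - 2 * M ≤ z 1 ∧ z 1 ≤ 2 * r + 2 * M := by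
    intro z hz
    rcases hCmem z hz with hz | hz | hz | hz
    · exact (hWR z hz).2
    · exact (hWD z hz).2
    · exact (hWL z hz).2
    · exact (hWU z hz).2
  -- the white path, refined in mode H, avoids `C`
  obtain ⟨tπ, htπ⟩ : ∃ t, π.getLast? = some t := by
    cases π with
    | nil => simp at hhπ
    | cons x l => exact ⟨_, List.getLast?_eq_some_getLast (List.cons_ne_nil x l)⟩
  obtain ⟨P, hmemP, hP⟩ := refineH_chain (S := Kᶜ) (A := A) π _ _ hcπ hhπ htπ fun x hx => hKπ x hx
  have hdisj : ∀ z ∈ P.support, z ∉ C.support := by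
    intro z hzP hzC
    rcases hCmem z hzC with hz | hz | hz | hz
    · exact own_disjoint (hWR z hz).1 (hP z hzP).1
    · exact own_disjoint (hWD z hz).1 (hP z hzP).1
    · exact own_disjoint (hWL z hz).1 (hP z hzP).1
    · exact own_disjoint (hWU z hz).1 (hP z hzP).1
  -- the winding number of `C` around the doubled white wall cell is `-1`
  have hWRval : walkWinding WR (triDouble ![a, r]) = -1 := by
    have h1 := hU u hu
    have h2 := hD v hv
    rw [hWRw fun x hx => (hγR x hx).2.1, if_neg (by omega), if_pos (by omega)]
    norm_num
  have hWLval : walkWinding WL (triDouble ![a, r]) = 0 := hWLw fun x hx => (hγL x hx).2.1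
  have hWC : walkWinding C (triDouble ![a, r]) = -1 := by
    simp only [hC, walkWinding_append, walkWinding_reverse, hWRval, hWLval, hWU0, hWD0]; norm_num
  -- constancy along the white path, and the box
  have hw' : walkWinding C (triDouble w) ≠ 0 := by
    rw [walkWinding_closed_const C P hdisj (triDouble w) (hmemP w hw), hWC]; norm_num
  have hbox := walkWinding_closed_box C hCbox hw'
  simp only [triDouble_apply_zero, triDouble_apply_one] at hbox
  exact ⟨abs_le.2 ⟨by omega, by omega⟩, abs_le.2 ⟨by omega, by omega⟩⟩

end Summit.CriticalPhenomena.CardyFormulaZ2.Theorems.IKLinearTransport.PinnedDiagramExchange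

end
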